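import Summits.CriticalPhenomena.PercolationContinuityZ3.Theorems.PercNearOneGluingNoHeavyLowerTailSunflowerLocalAssignment
import Summits.CriticalPhenomena.PercolationContinuityZ3.Theorems.PercNearOneGluingNoHeavyLowerTailSunflowerUpReaderExact
import HarnessLib
import HarnessLib.Audit

/-!
# `NoHeavyLowerTail` (crux stmt-CriticalPhenomena-4575), abstract sunflower cubic: ★ FROM AN ASSIGNMENT TO JUNK-FREE BOTTOM SLOTS
# (the exact up-reader in the local assignment theorem)

Support file (seat `prim-l12-p2` gen 24; `--supports stmt-CriticalPhenomena-4575`).  No `sorry`, no new definitions.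
Memo: run/shared/lean/prim/prim-l12/prim-l12-p2/FINDING-g24-LOCAL-ASSIGNMENT.md (§3).

`…SunflowerLocalAssignment` proved ★ for sunflowers whose rainbows can be assigned to RIVAL-FREE bottom slots (plus private kernel supplies);
`…SunflowerUpReaderExact` computed the reading `⟨Λ_{P0}, ν_{P'}⟩ = [P0 ⊆ P'] + J_W(P0,P')` with the JUNK
`J_W(P0,P') = Σ_{T ⊆ W, lab T = 1} #{R1 ∈ A : P0 ⊆ R1 ⊆ W∖T} · #{R ∈ A : P'∪T ⊆ R ⊆ W}` (mod 2; only rivals `T` of `P0` contribute).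
Here the two are combined:
* `Sunflower.blockIndependent_of_junkFree` — at a bottom block `S`, rainbows with pairwise distinct `Q1`, each having `S` as a slot, and with
  `J_{Sᶜ}(Q1ρ, Q1ρ') = 0` for all pairs (including `ρ = ρ'`), are independent there (the exact up-reader of the `|Q1|`-maximal member of a
  dependency isolates its coefficient).  Rival-free `Q1` have `J ≡ 0`, so this contains `blockIndependent_of_rivalFree`.
* **`Sunflower.ZH_nonneg_of_junkFreeAssignment`** (unconditional class theorem): if the rainbows can be assigned to bottom slots that are
  junk-free against the other rainbows assigned to the same block (distinct `Q1` per block) and to kernel blocks with private supplies, then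
  `0 ≤ ZH`.  CENSUS (gen 24, `code/gsm4.c`, REFINED=1, singleton kernel blocks, fixed petal order): such an assignment exists in 2 155/2 156 random
  sunflowers on 6 points, 3 000/3 000 resp. 599/600 'hard' (all petals non-intersecting) sunflowers on 6 resp. 7 points (rival-free version:
  2 134, 3 000, 535; gen 23's global hypothesis: 82/3 000 at n = 7); bottom slots alone (⟹ Lemma B) in 568/600 at n = 7.
-/

namespace Summit.CriticalPhenomena.PercolationContinuityZ3.Theorems.SunflowerPartition

open Finset

variable {α : Type*} [Fintype α] [DecidableEq α]

namespace Sunflower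

variable (F : Sunflower α)

/-- **JUNK-FREE BOTTOM SLOTS** (this work).  Let `lab S = 0` and let `R` be a set of rainbows with pairwise distinct `Q1`, each having `S` as a
slot (`S ⊆ Q3`, `lab (Sᶜ ∖ Q1) = 4`, `#{R' ∈ B : S ⊆ R' ⊆ Q3}` odd), such that the junk `J_{Sᶜ}(Q1ρ, Q1ρ')` of the exact up-reader vanishes for
all `ρ, ρ' ∈ R`.  Then the vectors `rbVec ρ`, `ρ ∈ R`, restricted to the supplies with spectator `S`, are linearly independent. [this work] -/
theorem blockIndependent_of_junkFree {S : Finset α} (hS0 : F.lab S = 0) (R : Finset (Finset α × Finset α))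
    (hR : R ⊆ F.dem.filter (fun d => F.IsRainbow d))
    (hslot : ∀ ρ ∈ R, S ⊆ (ρ.1 ∪ ρ.2)ᶜ ∧ F.lab (Sᶜ \ ρ.1) = 4 ∧
      (∑ R' ∈ (Finset.univ : Finset α).powerset, (if F.lab R' = 0 ∧ S ⊆ R' ∧ R' ⊆ (ρ.1 ∪ ρ.2)ᶜ then (1 : ZMod 2) else 0)) = 1)
    (hjunk : ∀ ρ ∈ R, ∀ ρ' ∈ R,
      (∑ T ∈ (Sᶜ).powerset, (if F.lab T = 1 then
        (∑ R1 ∈ (Sᶜ).powerset, (if F.lab R1 = 4 ∧ ρ.1 ⊆ R1 ∧ T ⊆ Sᶜ \ R1 then (1 : ZMod 2) else 0)) *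
        (∑ R2 ∈ (Sᶜ).powerset, (if F.lab R2 = 4 ∧ ρ'.1 ⊆ R2 ∧ T ⊆ R2 then (1 : ZMod 2) else 0)) else 0)) = 0)
    (hinj : ∀ ρ ∈ R, ∀ ρ' ∈ R, ρ.1 = ρ'.1 → ρ = ρ') :
    LinearIndependent (ZMod 2) (fun ρ : ↥R => fun σ : ↥(F.sup.filter (fun σ => σ.2 = S)) => F.rbVec ρ.1 σ.1) := by
  classical
  rw [Fintype.linearIndependent_iff]
  intro g hg
  by_contra hne
  push Not at hne
  obtain ⟨i₀, hi₀⟩ := hne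
  have rfacts : ∀ i : ↥R, i.1 ∈ F.dem ∧ F.IsRainbow i.1 := fun i => ⟨(mem_filter.1 (hR i.2)).1, (mem_filter.1 (hR i.2)).2⟩
  have hsum : ∀ σ ∈ F.sup, σ.2 = S → (∑ i : ↥R, g i * F.rbVec i.1 σ) = 0 := by
    intro σ hσ hσS
    have h := congrFun hg ⟨σ, mem_filter.2 ⟨hσ, hσS⟩⟩
    simp only [Finset.sum_apply, Pi.smul_apply, smul_eq_mul, Pi.zero_apply] at h
    exact h
  obtain ⟨s, hsT, hmax⟩ := Finset.exists_max_image ((Finset.univ : Finset ↥R).filter (fun i => g i ≠ 0))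
    (fun i : ↥R => i.1.1.card) ⟨i₀, mem_filter.2 ⟨mem_univ _, hi₀⟩⟩
  have hgs : g s ≠ 0 := (mem_filter.1 hsT).2
  obtain ⟨hSs, hS4, hPhi⟩ := hslot s.1 s.2
  have hPS : s.1.1 ⊆ Sᶜ := by
    intro x hx; rw [mem_compl]; intro hxS
    have := hSs hxS; rw [mem_compl, mem_union, not_or] at this; exact this.1 hx
  -- the junk of the pair `(s, i)`
  set J : ↥R → ZMod 2 := fun i => ∑ T ∈ (Sᶜ).powerset, (if F.lab T = 1 then
      (∑ R1 ∈ (Sᶜ).powerset, (if F.lab R1 = 4 ∧ s.1.1 ⊆ R1 ∧ T ⊆ Sᶜ \ R1 then (1 : ZMod 2) else 0)) *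
      (∑ R2 ∈ (Sᶜ).powerset, (if F.lab R2 = 4 ∧ i.1.1 ⊆ R2 ∧ T ⊆ R2 then (1 : ZMod 2) else 0)) else 0) with hJ
  have hJ0 : ∀ i : ↥R, J i = 0 := fun i => hjunk s.1 s.2 i.1 i.2
  -- per-rainbow reading of `Λ_{Q1 s}` (raw pairing + exact up-reader)
  have hread : ∀ i : ↥R, (∑ Y ∈ (Sᶜ \ s.1.1).powerset, (if F.lab (Sᶜ \ Y) = 4 then
      ∑ σ ∈ F.sup, (if σ.2 = S then
        (∑ R' ∈ (Sᶜ).powerset, (if F.lab R' = 0 ∧ (σ.1 ∪ σ.2)ᶜ ⊆ R' ∧ R' ⊆ Y then (1 : ZMod 2) else 0)) * F.rbVec i.1 σ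
        else 0) else 0))
      = (if F.lab S = 0 ∧ S ⊆ (i.1.1 ∪ i.1.2)ᶜ ∧ F.lab (Sᶜ \ i.1.1) = 4 then
          (∑ R' ∈ (Finset.univ : Finset α).powerset, (if F.lab R' = 0 ∧ S ⊆ R' ∧ R' ⊆ (i.1.1 ∪ i.1.2)ᶜ then (1 : ZMod 2) else 0))
          else 0) * ((if s.1.1 ⊆ i.1.1 then 1 else 0) + J i) := by
    intro i
    obtain ⟨hid, hir⟩ := rfacts i
    by_cases hc : F.lab S = 0 ∧ S ⊆ (i.1.1 ∪ i.1.2)ᶜ ∧ F.lab (Sᶜ \ i.1.1) = 4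
    · rw [if_pos hc]
      have hQ1S : i.1.1 ⊆ Sᶜ := by
        intro x hx; rw [mem_compl]; intro hxS
        have := hc.2.1 hxS; rw [mem_compl, mem_union, not_or] at this; exact this.1 hx
      rw [hJ, ← F.nu_read_up_exact Sᶜ hPS hQ1S hS4 (F.dem_rainbow_facts hid hir).2.1, Finset.mul_sum]
      refine sum_congr rfl fun Y hY => ?_
      have hYS : Y ⊆ Sᶜ := (mem_powerset.1 hY).trans sdiff_subset
      by_cases hY4 : F.lab (Sᶜ \ Y) = 4
      · rw [if_pos hY4, if_pos hY4, F.rbVec_pair_bottom_raw hid hir hS0 hYS, if_pos hc]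
      · rw [if_neg hY4, if_neg hY4, mul_zero]
    · rw [if_neg hc, zero_mul]
      refine sum_eq_zero fun Y hY => ?_
      have hYS : Y ⊆ Sᶜ := (mem_powerset.1 hY).trans sdiff_subset
      by_cases hY4 : F.lab (Sᶜ \ Y) = 4
      · rw [if_pos hY4, F.rbVec_pair_bottom_raw hid hir hS0 hYS, if_neg hc]
      · rw [if_neg hY4]
  -- linearity
  have hlin : ∀ Y, (∑ σ ∈ F.sup, (if σ.2 = S then
        (∑ R' ∈ (Sᶜ).powerset, (if F.lab R' = 0 ∧ (σ.1 ∪ σ.2)ᶜ ⊆ R' ∧ R' ⊆ Y then (1 : ZMod 2) else 0)) *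
          (∑ i : ↥R, g i * F.rbVec i.1 σ) else 0))
      = ∑ i : ↥R, g i * ∑ σ ∈ F.sup, (if σ.2 = S then
        (∑ R' ∈ (Sᶜ).powerset, (if F.lab R' = 0 ∧ (σ.1 ∪ σ.2)ᶜ ⊆ R' ∧ R' ⊆ Y then (1 : ZMod 2) else 0)) * F.rbVec i.1 σ
        else 0) := by
    intro Y
    rw [show (∑ i : ↥R, g i * ∑ σ ∈ F.sup, (if σ.2 = S then
          (∑ R' ∈ (Sᶜ).powerset, (if F.lab R' = 0 ∧ (σ.1 ∪ σ.2)ᶜ ⊆ R' ∧ R' ⊆ Y then (1 : ZMod 2) else 0)) * F.rbVec i.1 σ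
          else 0))
        = ∑ i : ↥R, ∑ σ ∈ F.sup, g i * (if σ.2 = S then
          (∑ R' ∈ (Sᶜ).powerset, (if F.lab R' = 0 ∧ (σ.1 ∪ σ.2)ᶜ ⊆ R' ∧ R' ⊆ Y then (1 : ZMod 2) else 0)) * F.rbVec i.1 σ
          else 0) from sum_congr rfl fun i _ => Finset.mul_sum _ _ _]
    rw [Finset.sum_comm]
    refine sum_congr rfl fun σ _ => ?_
    by_cases h : σ.2 = S
    · rw [if_pos h, Finset.mul_sum]
      refine sum_congr rfl fun i _ => ?_
      rw [if_pos h]; ring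
    · rw [if_neg h]
      symm
      exact sum_eq_zero fun i _ => by rw [if_neg h, mul_zero]
  -- the functional applied to the dependency vanishes
  have hzero : (∑ i : ↥R, g i * ((if F.lab S = 0 ∧ S ⊆ (i.1.1 ∪ i.1.2)ᶜ ∧ F.lab (Sᶜ \ i.1.1) = 4 then
          (∑ R' ∈ (Finset.univ : Finset α).powerset, (if F.lab R' = 0 ∧ S ⊆ R' ∧ R' ⊆ (i.1.1 ∪ i.1.2)ᶜ then (1 : ZMod 2) else 0))
          else 0) * ((if s.1.1 ⊆ i.1.1 then 1 else 0) + J i))) = 0 := by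
    rw [show (∑ i : ↥R, g i * ((if F.lab S = 0 ∧ S ⊆ (i.1.1 ∪ i.1.2)ᶜ ∧ F.lab (Sᶜ \ i.1.1) = 4 then
          (∑ R' ∈ (Finset.univ : Finset α).powerset, (if F.lab R' = 0 ∧ S ⊆ R' ∧ R' ⊆ (i.1.1 ∪ i.1.2)ᶜ then (1 : ZMod 2) else 0))
          else 0) * ((if s.1.1 ⊆ i.1.1 then 1 else 0) + J i)))
        = ∑ i : ↥R, ∑ Y ∈ (Sᶜ \ s.1.1).powerset, g i * (if F.lab (Sᶜ \ Y) = 4 then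
            ∑ σ ∈ F.sup, (if σ.2 = S then
              (∑ R' ∈ (Sᶜ).powerset, (if F.lab R' = 0 ∧ (σ.1 ∪ σ.2)ᶜ ⊆ R' ∧ R' ⊆ Y then (1 : ZMod 2) else 0)) * F.rbVec i.1 σ
              else 0) else 0) from
      sum_congr rfl fun i _ => by rw [← hread i, Finset.mul_sum]]
    rw [Finset.sum_comm]
    refine sum_eq_zero fun Y _ => ?_
    by_cases hY4 : F.lab (Sᶜ \ Y) = 4
    · rw [show (∑ i : ↥R, g i * (if F.lab (Sᶜ \ Y) = 4 then
            ∑ σ ∈ F.sup, (if σ.2 = S then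
              (∑ R' ∈ (Sᶜ).powerset, (if F.lab R' = 0 ∧ (σ.1 ∪ σ.2)ᶜ ⊆ R' ∧ R' ⊆ Y then (1 : ZMod 2) else 0)) * F.rbVec i.1 σ
              else 0) else 0))
          = ∑ i : ↥R, g i * ∑ σ ∈ F.sup, (if σ.2 = S then
              (∑ R' ∈ (Sᶜ).powerset, (if F.lab R' = 0 ∧ (σ.1 ∪ σ.2)ᶜ ⊆ R' ∧ R' ⊆ Y then (1 : ZMod 2) else 0)) * F.rbVec i.1 σ
              else 0) from sum_congr rfl fun i _ => by rw [if_pos hY4]]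
      rw [← hlin Y]
      refine sum_eq_zero fun σ hσ => ?_
      by_cases h : σ.2 = S
      · rw [if_pos h, hsum σ hσ h, mul_zero]
      · rw [if_neg h]
    · exact sum_eq_zero fun i _ => by rw [if_neg hY4, mul_zero]
  -- only `ρ*` survives
  rw [← Finset.sum_erase_add _ _ (mem_univ s)] at hzero
  rw [show (∑ i ∈ (Finset.univ : Finset ↥R).erase s, g i * ((if F.lab S = 0 ∧ S ⊆ (i.1.1 ∪ i.1.2)ᶜ ∧ F.lab (Sᶜ \ i.1.1) = 4 then
          (∑ R' ∈ (Finset.univ : Finset α).powerset, (if F.lab R' = 0 ∧ S ⊆ R' ∧ R' ⊆ (i.1.1 ∪ i.1.2)ᶜ then (1 : ZMod 2) else 0))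
          else 0) * ((if s.1.1 ⊆ i.1.1 then 1 else 0) + J i))) = 0 from
    sum_eq_zero fun i hi => by
      by_cases hgi : g i = 0
      · rw [hgi, zero_mul]
      · have hiT : i ∈ (Finset.univ : Finset ↥R).filter (fun i => g i ≠ 0) := mem_filter.2 ⟨mem_univ _, hgi⟩
        have hPi : ¬ s.1.1 ⊆ i.1.1 := by
          intro hPi
          have heq : i.1.1 = s.1.1 := (Finset.eq_of_subset_of_card_le hPi (hmax i hiT)).symm
          exact (mem_erase.1 hi).1 (Subtype.ext (hinj i.1 i.2 s.1 s.2 heq))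
        rw [if_neg hPi, hJ0 i, add_zero, mul_zero, mul_zero], zero_add] at hzero
  rw [if_pos ⟨hS0, hSs, hS4⟩, hPhi, if_pos (subset_refl _), hJ0 s, add_zero, mul_one, mul_one] at hzero
  exact hgs hzero

/-- **★ FOR SUNFLOWERS WITH A JUNK-FREE LOCAL ASSIGNMENT** (this work; unconditional).  Suppose every rainbow `ρ = (Q1,Q2,Q3)` is assigned a
block `f ρ` which is EITHER a bottom slot of `ρ` (`lab (f ρ) = 0`, `f ρ ⊆ Q3`, `lab ((f ρ)ᶜ ∖ Q1) = 4`, `#{R' ∈ B : f ρ ⊆ R' ⊆ Q3}` odd) whose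
exact-up-reader junk `J_{(f ρ)ᶜ}(Q1ρ, Q1ρ')` vanishes against every rainbow `ρ'` assigned to the same block, OR a kernel block (`lab (f ρ) = 4`)
carrying a supply where `rbVec ρ ≠ 0` and the vectors of all other rainbows assigned to that block vanish; and suppose rainbows assigned to the
same bottom block have distinct `Q1`.  Then `0 ≤ ZH`. [this work] -/
theorem ZH_nonneg_of_junkFreeAssignment (f : Finset α × Finset α → Finset α)
    (hgood : ∀ ρ ∈ F.dem.filter (fun d => F.IsRainbow d),
      (F.lab (f ρ) = 0 ∧ f ρ ⊆ (ρ.1 ∪ ρ.2)ᶜ ∧ F.lab ((f ρ)ᶜ \ ρ.1) = 4 ∧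
        (∑ R' ∈ (Finset.univ : Finset α).powerset, (if F.lab R' = 0 ∧ f ρ ⊆ R' ∧ R' ⊆ (ρ.1 ∪ ρ.2)ᶜ then (1 : ZMod 2) else 0)) = 1 ∧
        ∀ ρ' ∈ F.dem.filter (fun d => F.IsRainbow d), f ρ' = f ρ →
          (∑ T ∈ ((f ρ)ᶜ).powerset, (if F.lab T = 1 then
            (∑ R1 ∈ ((f ρ)ᶜ).powerset, (if F.lab R1 = 4 ∧ ρ.1 ⊆ R1 ∧ T ⊆ (f ρ)ᶜ \ R1 then (1 : ZMod 2) else 0)) *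
            (∑ R2 ∈ ((f ρ)ᶜ).powerset, (if F.lab R2 = 4 ∧ ρ'.1 ⊆ R2 ∧ T ⊆ R2 then (1 : ZMod 2) else 0)) else 0)) = 0) ∨
      (F.lab (f ρ) = 4 ∧ ∃ σ ∈ F.sup, σ.2 = f ρ ∧ F.rbVec ρ σ ≠ 0 ∧
        ∀ ρ' ∈ F.dem.filter (fun d => F.IsRainbow d), f ρ' = f ρ → ρ' ≠ ρ → F.rbVec ρ' σ = 0))
    (hinj : ∀ ρ ∈ F.dem.filter (fun d => F.IsRainbow d), ∀ ρ' ∈ F.dem.filter (fun d => F.IsRainbow d),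
      f ρ = f ρ' → F.lab (f ρ) = 0 → ρ.1 = ρ'.1 → ρ = ρ') :
    0 ≤ F.ZH := by
  classical
  refine F.ZH_nonneg_of_blockAssignment f (fun ρ hρ => ?_) (fun S hS => ?_)
  · rcases hgood ρ hρ with h | h
    · exact Or.inr h.1
    · exact Or.inl h.1
  · rcases hS with hS4 | hS0
    · refine F.blockIndependent_of_private S _ fun ρ hρ => ?_
      obtain ⟨hρr, hρS⟩ := mem_filter.1 hρ
      rcases hgood ρ hρr with h | h
      · rw [hρS, hS4] at h; exact absurd h.1 (by decide)
      · obtain ⟨-, σ, hσ, hσS, hnz, hoth⟩ := h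
        refine ⟨σ, hσ, by rw [hσS, hρS], hnz, fun ρ' hρ' hne => ?_⟩
        obtain ⟨hρ'r, hρ'S⟩ := mem_filter.1 hρ'
        exact hoth ρ' hρ'r (by rw [hρ'S, hρS]) hne
    · refine F.blockIndependent_of_junkFree hS0 _ (Finset.filter_subset _ _) (fun ρ hρ => ?_) (fun ρ hρ ρ' hρ' => ?_)
        (fun ρ hρ ρ' hρ' heq => ?_)
      · obtain ⟨hρr, hρS⟩ := mem_filter.1 hρ
        rcases hgood ρ hρr with h | h
        · obtain ⟨-, h2, h3, h4, -⟩ := h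
          rw [hρS] at h2 h3 h4
          exact ⟨h2, h3, h4⟩
        · rw [hρS, hS0] at h; exact absurd h.1 (by decide)
      · obtain ⟨hρr, hρS⟩ := mem_filter.1 hρ
        obtain ⟨hρ'r, hρ'S⟩ := mem_filter.1 hρ'
        rcases hgood ρ hρr with h | h
        · obtain ⟨-, -, -, -, h5⟩ := h
          have := h5 ρ' hρ'r (by rw [hρ'S, hρS])
          rw [hρS] at this
          exact this
        · rw [hρS, hS0] at h; exact absurd h.1 (by decide)
      · obtain ⟨hρr, hρS⟩ := mem_filter.1 hρ
        obtain ⟨hρ'r, hρ'S⟩ := mem_filter.1 hρ'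
        exact hinj ρ hρr ρ' hρ'r (by rw [hρS, hρ'S]) (by rw [hρS]; exact hS0) heq

end Sunflower

end Summit.CriticalPhenomena.PercolationContinuityZ3.Theorems.SunflowerPartition
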